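import Literature.Probability.RandomPlanarGeometry.StarHullExtension
import Literature.Probability.RandomPlanarGeometry.HullSubdomainPullback
import Literature.Probability.RandomPlanarGeometry.ConformalMapProofs
import Mathlib.Analysis.Complex.RemovableSingularity
import HarnessLib

/-!
# Crux `SAWDevelopingMap.ObservableToSLE` (stmt-CriticalPhenomena-10472), line
`floor-ratio-restriction-bootstrap`: the coalescence computation for the mechanism stub
`stub_restrictionCocycle`

Landing target:
`Summits/CriticalPhenomena/SAWScalingLimit/Theorems/SAWDevelopingMapObservableToSLERestrictionCocycleHelpersCoalescence.lean`
(`--supports stmt-CriticalPhenomena-10472`).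

With `φ : (ℍ; 0, ∞) → (D; a, b)` chordal uniformizing, `A = φ.pullbackHull D'` the hull of a hull
subdomain, `Φ_A` its restriction map and `E = hullExt Φ_A` the Schwarz reflection of `Φ_A`, the two
half-plane maps of the bootstrap are `Ψ = -1/φ⁻¹ : D → ℍ` and `Ψ' = -1/(Φ_A ∘ φ⁻¹) : D' → ℍ`, and

  `Ψ'' / Ψ' = N(φ⁻¹)`,  `N(w) = E'(w) w² / E(w)²`

(`deriv_halfPlaneMap_pullback`).  The moduli of the bootstrap are the values of `N` at the boundary:
`N → 1` at `∞` (hydrodynamic normalisation `E(w) - w → L`, whence `E' → 1`: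
`tendsto_deriv_hullExt_cocompact`, `tendsto_derivRatio_cocompact`) and `N(q) → 1/Φ_A'(0)` as the
real point `q → 0` (`tendsto_derivRatio_zero`), `N` being continuous at the good real points
(`continuousAt_derivRatio`).  The identification of `exp` of a difference of boundary limits of two
logarithms with the boundary limit of `N` is `exp_sub_eq_of_tendsto`.
-/

noncomputable section

open scoped Topology Real
open Filter Set Metric Complex Bornology Function
open Literature.Probability.RandomPlanarGeometry
open UpperHalfPlane (upperHalfPlaneSet isOpen_upperHalfPlaneSet)

namespace Summit.CriticalPhenomena.SAWScalingLimit.Theorems.ObservableToSLE.FloorRatio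

variable {B : Set ℂ} {Φ : ConformalEquiv (upperHalfPlaneSet \ B) upperHalfPlaneSet}

/-! ### `E_B'(z) → 1` at infinity -/

/-- **The derivative of the reflected restriction map tends to `1` at infinity.**  `E_B(z) - z → L`
at `∞` (`tendsto_hullExt_sub_self`), so the inverted function `k(ζ) = E_B(1/ζ) - 1/ζ` has a removable
singularity at `0`; differentiating `E_B(z) = z + k(1/z)` gives `E_B'(z) = 1 - k'(1/z)/z² → 1`.
Lawler (2005), §3.4 (expansion of `g_A` at `∞`). [cite: Lawler2005, §3.4 proof of Prop. 3.36] -/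
theorem tendsto_deriv_hullExt_cocompact (hB : IsBoundedHull B) (hΦ : IsRestrictionMap B Φ) :
    Tendsto (deriv (hullExt Φ)) (cocompact ℂ) (𝓝 1) := by
  obtain ⟨R, hR, hRΩ⟩ := exists_forall_mem_symmDomain hB
  set k : ℂ → ℂ := fun ζ ↦ hullExt Φ ζ⁻¹ - ζ⁻¹ with hk
  set kt : ℂ → ℂ := update k 0 (hullShift Φ) with hkt
  -- `k` is holomorphic on the punctured disc `0 < |ζ| < 1/R`
  have hkd : ∀ ζ : ℂ, ζ ≠ 0 → ‖ζ‖ < R⁻¹ → DifferentiableAt ℂ k ζ := by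
    intro ζ hζ0 hζ
    have hz : R < ‖ζ⁻¹‖ := by
      rw [norm_inv]; rwa [lt_inv_comm₀ hR (norm_pos_iff.2 hζ0)]
    exact ((differentiableAt_hullExt hB hΦ (hRΩ _ hz)).comp ζ (differentiableAt_inv hζ0)).sub
      (differentiableAt_inv hζ0)
  have hpunct : {(0 : ℂ)}ᶜ ∩ ball (0 : ℂ) R⁻¹ ∈ 𝓝[≠] (0 : ℂ) :=
    inter_mem_nhdsWithin _ (ball_mem_nhds (0 : ℂ) (inv_pos.2 hR))
  have hktd : ∀ᶠ ζ in 𝓝[≠] (0 : ℂ), DifferentiableAt ℂ kt ζ := by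
    filter_upwards [hpunct] with ζ hζ
    have hζ0 : ζ ≠ 0 := hζ.1
    have hev : kt =ᶠ[𝓝 ζ] k := by
      filter_upwards [isOpen_ne.mem_nhds hζ0] with w hw
      exact update_of_ne hw _ _
    exact (hkd ζ hζ0 (mem_ball_zero_iff.1 hζ.2)).congr_of_eventuallyEq hev
  -- `k → L` at `0`, so `kt` is continuous at `0` and analytic there
  have hk0 : Tendsto k (𝓝[≠] 0) (𝓝 (hullShift Φ)) := by
    have hinv : Tendsto (fun ζ : ℂ ↦ ζ⁻¹) (𝓝[≠] 0) (cocompact ℂ) := by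
      rw [← cobounded_eq_cocompact]; exact tendsto_inv₀_nhdsNE_zero
    exact (tendsto_hullExt_sub_self hB hΦ).comp hinv
  have hktc : ContinuousAt kt 0 := by
    rw [continuousAt_update_same]
    exact hk0
  have hkta : AnalyticAt ℂ kt 0 :=
    Complex.analyticAt_of_differentiable_on_punctured_nhds_of_continuousAt hktd hktc
  -- `kt` is differentiable near `0`, with continuous derivative at `0`
  have hktd' : ∀ᶠ ζ in 𝓝 (0 : ℂ), DifferentiableAt ℂ kt ζ :=
    hkta.eventually_analyticAt.mono fun ζ hζ ↦ hζ.differentiableAt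
  have hdc : ContinuousAt (deriv kt) 0 := hkta.deriv.continuousAt
  obtain ⟨ε, hε, hεd⟩ := Metric.eventually_nhds_iff_ball.1 hktd'
  -- `E_B'(z) = 1 - kt'(1/z)/z²` far out
  have hinv0 : Tendsto (fun z : ℂ ↦ z⁻¹) (cocompact ℂ) (𝓝 0) := by
    rw [← cobounded_eq_cocompact]; exact tendsto_inv₀_cobounded
  have hfar : ∀ᶠ z in cocompact ℂ, deriv (hullExt Φ) z = 1 + deriv kt z⁻¹ * (-(z ^ 2)⁻¹) := by
    have h1 : ∀ᶠ z in cocompact ℂ, R < ‖z‖ := by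
      rw [← cobounded_eq_cocompact]
      exact (hasBasis_cobounded_compl_closedBall (0 : ℂ)).eventually_iff.2
        ⟨R, trivial, fun z hz ↦ by simpa using hz⟩
    have h2 : ∀ᶠ z in cocompact ℂ, z⁻¹ ∈ ball (0 : ℂ) ε := hinv0 (ball_mem_nhds 0 hε)
    filter_upwards [h1, h2] with z hz hzε
    have hz0 : z ≠ 0 := by rintro rfl; simp at hz; linarith
    -- `E = id + kt ∘ inv` near `z`
    have hev : hullExt Φ =ᶠ[𝓝 z] fun w ↦ w + kt w⁻¹ := by
      filter_upwards [isOpen_ne.mem_nhds hz0] with w hw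
      have hw' : (w : ℂ)⁻¹ ≠ 0 := inv_ne_zero hw
      rw [hkt, update_of_ne hw']
      simp [hk, inv_inv]
    rw [hev.deriv_eq]
    have hc : HasDerivAt (fun w : ℂ ↦ kt w⁻¹) (deriv kt z⁻¹ * (-(z ^ 2)⁻¹)) z :=
      (hεd _ hzε).hasDerivAt.comp z (hasDerivAt_inv hz0)
    exact ((hasDerivAt_id z).add hc).deriv
  -- pass to the limit
  have hlim : Tendsto (fun z : ℂ ↦ 1 + deriv kt z⁻¹ * (-(z ^ 2)⁻¹)) (cocompact ℂ) (𝓝 1) := by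
    have h1 : Tendsto (fun z : ℂ ↦ deriv kt z⁻¹) (cocompact ℂ) (𝓝 (deriv kt 0)) :=
      hdc.tendsto.comp hinv0
    have h2 : Tendsto (fun z : ℂ ↦ -(z ^ 2)⁻¹) (cocompact ℂ) (𝓝 0) := by
      have h3 : Tendsto (fun z : ℂ ↦ z ^ 2) (cocompact ℂ) (cobounded ℂ) := by
        rw [← cobounded_eq_cocompact, ← tendsto_norm_atTop_iff_cobounded]
        have : Tendsto (fun z : ℂ ↦ ‖z‖ ^ 2) (cobounded ℂ) atTop :=
          (tendsto_pow_atTop two_ne_zero).comp tendsto_norm_cobounded_atTop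
        exact this.congr fun z ↦ (norm_pow z 2).symm
      simpa using (tendsto_inv₀_cobounded.comp h3).neg
    simpa using (h1.mul h2).const_add 1
  exact (hlim.congr' (hfar.mono fun z hz ↦ hz.symm))

/-! ### The derivative ratio `N(w) = E'(w) w² / E(w)²` -/

/-- **`N(w) = E'(w) w²/E(w)² → 1` at infinity** (`E(w)/w → 1`, `E'(w) → 1`).
[cite: Lawler2005, §3.4 proof of Prop. 3.36] -/
theorem tendsto_derivRatio_cocompact (hB : IsBoundedHull B) (hΦ : IsRestrictionMap B Φ) :
    Tendsto (fun w ↦ deriv (hullExt Φ) w * w ^ 2 / hullExt Φ w ^ 2) (cocompact ℂ) (𝓝 1) := by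
  have h1 := tendsto_deriv_hullExt_cocompact hB hΦ
  have h2 := tendsto_hullExt_div hB hΦ
  have h3 : Tendsto (fun w ↦ deriv (hullExt Φ) w / (hullExt Φ w / w) ^ 2) (cocompact ℂ) (𝓝 1) := by
    have h := h1.div (h2.pow 2) (by norm_num)
    rw [one_pow, div_one] at h
    exact h
  have hne : ∀ᶠ w in cocompact ℂ, w ≠ 0 := by
    rw [← cobounded_eq_cocompact]
    exact (hasBasis_cobounded_compl_closedBall (0 : ℂ)).eventually_iff.2
      ⟨0, trivial, fun z hz h ↦ by subst h; simp at hz⟩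
  refine h3.congr' ?_
  filter_upwards [hne] with w hw
  field_simp

/-- **`N(q) → 1/Φ_B'(0)` as the real point `q → 0`** (for a `*`-hull: `E(q)/q → E'(0) = d` and
`E'(q) → d`, so `N(q) = E'(q)/(E(q)/q)² → 1/d`). [cite: LawlerSchrammWerner2003Restriction, §2 (2.4) p. 7] -/
theorem tendsto_derivRatio_zero (hB : IsStarHull B) (hΦ : IsRestrictionMap B Φ) {d : ℝ}
    (hd : HasRestrictionDeriv B Φ d) (hd0 : 0 < d) :
    Tendsto (fun w ↦ deriv (hullExt Φ) w * w ^ 2 / hullExt Φ w ^ 2) (𝓝[≠] 0) (𝓝 ((d : ℂ)⁻¹)) := by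
  have hD := hasDerivAt_hullExt_zero hB hΦ hd
  -- `E(w)/w → d`
  have h1 : Tendsto (fun w ↦ hullExt Φ w / w) (𝓝[≠] 0) (𝓝 (d : ℂ)) := by
    refine ((hasDerivAt_iff_tendsto_slope.1 hD).congr' ?_)
    filter_upwards [self_mem_nhdsWithin] with w hw
    rw [slope_def_field, hullExt_zero hB hΦ, sub_zero, sub_zero]
  -- `E'(w) → d`
  have h2 : Tendsto (deriv (hullExt Φ)) (𝓝[≠] 0) (𝓝 (d : ℂ)) := by
    have ha : AnalyticAt ℂ (hullExt Φ) 0 :=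
      (differentiableOn_hullExt hB.isBoundedHull hΦ).analyticAt
        ((isOpen_symmDomain hB.isBoundedHull.isClosed).mem_nhds hB.zero_mem_symmDomain)
    have := ha.deriv.continuousAt.tendsto
    rw [deriv_hullExt_zero hB hΦ hd] at this
    exact this.mono_left nhdsWithin_le_nhds
  have hd' : (d : ℂ) ≠ 0 := by exact_mod_cast hd0.ne'
  have h3 : Tendsto (fun w ↦ deriv (hullExt Φ) w / (hullExt Φ w / w) ^ 2) (𝓝[≠] 0)
      (𝓝 ((d : ℂ) / (d : ℂ) ^ 2)) := h2.div (h1.pow 2) (pow_ne_zero 2 hd')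
  have heq : (d : ℂ) / (d : ℂ) ^ 2 = (d : ℂ)⁻¹ := by field_simp
  rw [heq] at h3
  refine h3.congr' ?_
  filter_upwards [self_mem_nhdsWithin] with w hw
  have hw0 : w ≠ 0 := hw
  field_simp

/-- **`N` is continuous at the good real points**: at `q ∈ symmDomain B` with `q ≠ 0`,
`E(q) ≠ 0`. [folklore] -/
theorem continuousAt_derivRatio (hB : IsBoundedHull B) (hΦ : IsRestrictionMap B Φ) {q : ℂ}
    (hq : q ∈ symmDomain B) (hEq : hullExt Φ q ≠ 0) :
    ContinuousAt (fun w ↦ deriv (hullExt Φ) w * w ^ 2 / hullExt Φ w ^ 2) q := by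
  have ha : AnalyticAt ℂ (hullExt Φ) q :=
    (differentiableOn_hullExt hB hΦ).analyticAt ((isOpen_symmDomain hB.isClosed).mem_nhds hq)
  refine ((ha.deriv.continuousAt.mul (continuousAt_id.pow 2)).div (ha.continuousAt.pow 2) ?_)
  exact pow_ne_zero 2 hEq

/-! ### The derivative of the pulled-back half-plane map -/

/-- **`Ψ'' = N(φ⁻¹) · Ψ'` on the hull subdomain.**  For `φ : ℍ → D` conformal, `D' ⊆ D`, `A` the
pulled-back hull (a bounded hull) with restriction map `Φ_A` and reflection `E = hullExt Φ_A`, and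
the two half-plane maps `Ψ = -1/φ⁻¹` on `D`, `Ψ' = -1/(Φ_A ∘ φ⁻¹)` on `D'`: at every `z ∈ D'`,
`Ψ'(z) ≠ 0` and `(Ψ')'(z) = N(φ⁻¹ z) · Ψ'(z)` with `N(w) = E'(w) w²/E(w)²` (chain rule).
[cite: LawlerSchrammWerner2003Restriction, §2 p. 9 (covariance under 𝒜₁), transposed] -/
theorem deriv_halfPlaneMap_pullback {D D' : DobrushinDomain}
    {φ : ConformalEquiv upperHalfPlaneSet D.carrier}
    {Φ : ConformalEquiv (upperHalfPlaneSet \ φ.pullbackHull D') upperHalfPlaneSet}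
    (hsub : D'.carrier ⊆ D.carrier) (hB : IsBoundedHull (φ.pullbackHull D'))
    (hΦ : IsRestrictionMap (φ.pullbackHull D') Φ)
    (Ψ : ConformalEquiv D.carrier upperHalfPlaneSet) (hΨ : ∀ z, Ψ z = -(φ.symm z)⁻¹)
    (Ψ' : ConformalEquiv D'.carrier upperHalfPlaneSet) (hΨ' : ∀ z, Ψ' z = -(Φ (φ.symm z))⁻¹)
    {z : ℂ} (hz : z ∈ D'.carrier) :
    deriv Ψ z ≠ 0 ∧ deriv Ψ' z =
      (deriv (hullExt Φ) (φ.symm z) * (φ.symm z) ^ 2 / hullExt Φ (φ.symm z) ^ 2) * deriv Ψ z := by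
  have hzD : z ∈ D.carrier := hsub hz
  -- `φ⁻¹` on `D'` takes values in `ℍ ∖ A`
  have hgA : ∀ w ∈ D'.carrier, φ.symm w ∈ upperHalfPlaneSet \ φ.pullbackHull D' := by
    intro w hw
    rw [ConformalEquiv.diff_pullbackHull]
    exact ConformalEquiv.symm_mapsTo_pullbackDomain hsub hw
  have hgd : HasDerivAt (φ.symm : ℂ → ℂ) (deriv φ.symm z) z :=
    (φ.symm.differentiableOn_coe.differentiableAt (D.isOpen.mem_nhds hzD)).hasDerivAt
  have hg0 : φ.symm z ≠ 0 := by
    intro h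
    have : (0 : ℂ) ∈ upperHalfPlaneSet := by rw [← h]; exact φ.symm_mapsTo hzD
    exact absurd this (by simp [upperHalfPlaneSet])
  have hg' : deriv φ.symm z ≠ 0 := ConformalEquiv.deriv_ne_zero_holds φ.symm D.isOpen hzD
  -- derivative of `Ψ = -1/φ⁻¹`
  have hΨd : HasDerivAt Ψ (deriv φ.symm z / φ.symm z ^ 2) z := by
    have h1 := (hgd.fun_inv hg0).fun_neg
    have heq : (Ψ : ℂ → ℂ) = fun w ↦ -(φ.symm w)⁻¹ := funext hΨ
    rw [heq]
    refine h1.congr_deriv ?_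
    ring
  -- derivative of `Ψ' = -1/(E ∘ φ⁻¹)` near `z`
  have hE0 : hullExt Φ (φ.symm z) ≠ 0 := by
    rw [hullExt_of_mem_diff (hgA z hz)]
    intro h
    have : (0 : ℂ) ∈ upperHalfPlaneSet := by rw [← h]; exact Φ.mapsTo (hgA z hz)
    exact absurd this (by simp [upperHalfPlaneSet])
  have hEd : HasDerivAt (hullExt Φ) (deriv (hullExt Φ) (φ.symm z)) (φ.symm z) :=
    (differentiableAt_hullExt hB hΦ (hB.mem_symmDomain_of_mem_diff (hgA z hz))).hasDerivAt
  have hΨ'd : HasDerivAt Ψ'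
      (deriv (hullExt Φ) (φ.symm z) * deriv φ.symm z / hullExt Φ (φ.symm z) ^ 2) z := by
    have hcomp : HasDerivAt (fun w ↦ hullExt Φ (φ.symm w))
        (deriv (hullExt Φ) (φ.symm z) * deriv φ.symm z) z := hEd.comp z hgd
    have h1 := (hcomp.fun_inv hE0).fun_neg
    have hev : (Ψ' : ℂ → ℂ) =ᶠ[𝓝 z] fun w ↦ -(hullExt Φ (φ.symm w))⁻¹ := by
      filter_upwards [D'.isOpen.mem_nhds hz] with w hw
      rw [hΨ', hullExt_of_mem_diff (hgA w hw)]
    refine (h1.congr_of_eventuallyEq hev).congr_deriv ?_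
    ring
  refine ⟨?_, ?_⟩
  · rw [hΨd.deriv]
    exact div_ne_zero hg' (pow_ne_zero 2 hg0)
  · rw [hΨ'd.deriv, hΨd.deriv]
    field_simp

/-! ### Identification of boundary limits -/

/-- **Boundary values of a quotient of exponentials.**  If `exp (L' - L) = h` on `S' ⊆ S`, `L → Lx`
at `x` within `S`, `L' → L'x` and `h → ν` at `x` within `S'`, and `x ∈ closure S'`, then
`exp (L'x - Lx) = ν`. [folklore] -/
theorem exp_sub_eq_of_tendsto {S S' : Set ℂ} (hS : S' ⊆ S) {x : ℂ} (hx : x ∈ closure S')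
    {L L' h : ℂ → ℂ} {Lx L'x ν : ℂ} (hL : Tendsto L (𝓝[S] x) (𝓝 Lx))
    (hL' : Tendsto L' (𝓝[S'] x) (𝓝 L'x)) (hh : Tendsto h (𝓝[S'] x) (𝓝 ν))
    (heq : ∀ z ∈ S', exp (L' z - L z) = h z) : exp (L'x - Lx) = ν := by
  haveI : (𝓝[S'] x).NeBot := mem_closure_iff_nhdsWithin_neBot.1 hx
  have h1 : Tendsto (fun z ↦ exp (L' z - L z)) (𝓝[S'] x) (𝓝 (exp (L'x - Lx))) :=
    ((continuous_exp.tendsto _).comp (hL'.sub (hL.mono_left (nhdsWithin_mono _ hS))))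
  have h2 : Tendsto (fun z ↦ exp (L' z - L z)) (𝓝[S'] x) (𝓝 ν) :=
    hh.congr' (eventually_nhdsWithin_of_forall fun z hz ↦ (heq z hz).symm)
  exact tendsto_nhds_unique h1 h2

/-! ### Registered form (sub-goal of `stub_restrictionCocycle`) -/

/-- **Registered sub-goal `stub_restrictionCocycle_derivAtInfinity`** (crux item
stmt-CriticalPhenomena-10472, line `floor-ratio-restriction-bootstrap`, mechanism stub
`stub_restrictionCocycle`): the derivative of the reflected restriction map of a bounded hull tends
to `1` at infinity (`tendsto_deriv_hullExt_cocompact`). [cite: Lawler2005, §3.4 proof of Prop. 3.36] -/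
theorem stub_restrictionCocycle_derivAtInfinity : ∀ (B : Set ℂ)
    (Φ : ConformalEquiv (upperHalfPlaneSet \ B) upperHalfPlaneSet),
    IsBoundedHull B → IsRestrictionMap B Φ → Tendsto (deriv (hullExt Φ)) (cocompact ℂ) (𝓝 1) :=
  fun _ _ hB hΦ => tendsto_deriv_hullExt_cocompact hB hΦ

end Summit.CriticalPhenomena.SAWScalingLimit.Theorems.ObservableToSLE.FloorRatio

end
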